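import Summits.QuantumAdvantage.QuantumAdvantage.Theorems.WbwObfuscatedGluedTreesKowRiVocabulary
import Literature.Computability.Cryptography.PseudorandomFunctions
import Literature.Computability.Complexity.CodeFP

/-!
# `WbwObfuscatedGluedTrees` (stmt-QuantumAdvantage-2340) — line `knowledge-of-walk-split`, STAGE 7: vocabulary of the
# COMPUTATIONAL real→ideal layer (the PRF hybrid: black-box clause (C) for the landed generator from PRF security)

Definitions file (no hardness asserted; no theorem content beyond unfolding / well-formedness lemmas) for stage 7 of the
line `knowledge-of-walk-split` of the INFORMAL crux `WbwObfuscatedGluedTrees` (route `Theses/WhiteBoxWalk`; lead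
prover-line-stmt-QuantumAdvantage-2340-c6-0).  Stage 5 (`…KnowledgeOfWalkSplit.BlackBox.blackBoxSoundness_holds`)
and stage 6 (`…KnowledgeOfWalkSplit.RealIdeal.idealCodeSoundness_holds`) bound every computationally unbounded
bit-oracle walker in IDEAL MODEL II — the generator's own naming / Feistel code (`codeNaming`, `codeCycle`) run over
four uniformly random `μ`-bit tables — and identified the landed generator's instance with that code run at the tables
of its own four PRF keys (`stub_codeLink`).  What separates ideal model II from the REAL instance of
`obfuscatedGluedTreesGen Λ O P` is exactly the replacement of the four keyed PRF instances `F_{k₁..k₄}` (at parameter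
`μ = Λ.prfParam n`, keys cut off the seed) by uniform tables: a COMPUTATIONAL step, valid against probabilistic
polynomial-time walkers only, by reduction to the pseudorandomness of the PRF.  Stage 7 carries it out in the tree's
uniform transcript model (`OracleAlg`, `OracleAdversary`, `IsPRF`).  This file is its vocabulary:

* §1 the BLACK-BOX WALK GAME against an instance `(σ, ν)`: the request oracle `walkOracle σ ν` (bit queries to the
  shipped neighbour circuit's functionality `bitOracle σ ν`, and the request for `name(ENTRANCE)`), the winning
  condition `WalkWin` (output a string with `name(EXIT)` as a prefix), the REAL success probability
  `walkSuccessProb Λ P 𝒜 n` of a PPT oracle adversary against the landed generator's instance at seed length `n`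
  (key material uniform, coins uniform), and **`BlackBoxClauseC Λ P`** — clause (C) of `WbwThesis` for walkers that
  use the instance as a black box; the ideal-II analogue `idealWalkSuccessProb`;
* §2 the SCHEDULED PRODUCT ENSEMBLE `schedEval Λ P` (`(n, K, i·x) ↦ F_{kᵢ}(x)`, `kᵢ = Λ.key n K i`, at parameter
  `Λ.prfParam n`) whose pseudorandomness (`IsPRF`, Goldreich 2001 Def. 3.6.4) is the hypothesis of stage 7, and the
  TABLES READ OFF AN ORACLE `tabOf μ O : CodeSpace μ` (through which every simulator of this stage accesses its
  oracle, so that the real PRF oracle reads as `tablesOf P μ k₁ k₂ k₃ k₄` and a uniformly random function oracle as a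
  uniform table quadruple);
* §3 ADAPTIVE STRAIGHT-LINE ORACLE PROGRAMS: `progAnswers` / `runProg` (plain data) and the transducer
  `adFnAlgL FQ FG m` (an `OracleAlg` asking `m` adaptive queries computed by a string map from the input and the coded
  answers so far, then post-processing) — the device by which the two simulator layers below are polynomial-time;
* (companion file `KowPhPrograms`) §4 LAYER B (cryptographic primitives over table lookups): the request codes, the program `primQ` / `primOut`
  (SIV encryption of a label: 2 lookups; recognition of a name: 2 lookups; one keyed Feistel permutation or its
  inverse: 4 lookups) and its specification `primSpec μ d T` (the generator's own `sivEnc`, `unname`, `prp` over the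
  table scheme `tabScheme T`);
* §5 LAYER C (the walk requests over layer B): the program `walkQ Λ` / `walkOut Λ` (recognise the queried name, read
  the leaf's cycle atom by three permutation calls, name the `≤ 3` neighbours, sort, assemble the answer string, read
  one bit) and its specification `reqSpec σ ν`.

[folklore] modelling conventions of the route; objects: ChildsEtAl2003 §2 / §4 Game 1, Goldreich2001 Def. 3.6.4
(oracle adversaries, the PRF game), LubyRackoff1988 (Feistel rounds), Goldreich2004FoC2 Constructions 5.3.9 / 5.4.19
(SIV naming), AroraBarak2009 §3.4 (oracle machines), LadnerLynchSelman1975 §3 (transducers).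
-/

set_option linter.dupNamespace false

noncomputable section

namespace Summit.QuantumAdvantage.QuantumAdvantage.Theorems.WbwObfuscatedGluedTrees.KnowledgeOfWalk.PrfHybrid

open Literature.Computability.Complexity Literature.Computability.QuantumComplexity
open Literature.Computability.QuantumComplexity.GluedTrees
open Literature.Computability.Cryptography Literature.Computability.Cryptography.ObfuscatedGluedTrees
open Summit.QuantumAdvantage.QuantumAdvantage.Theorems.WbwObfuscatedGluedTrees.KnowledgeOfWalk.BlackBox
open Summit.QuantumAdvantage.QuantumAdvantage.Theorems.WbwObfuscatedGluedTrees.KnowledgeOfWalk.RealIdeal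
open _root_.Computability

/-! ## §1 The black-box walk game -/

section Game

variable {d N : ℕ}

/-- **The request oracle of an instance** `(σ, ν)` — black-box access to what `gen s` ships: a BIT QUERY `0·q` is
answered by the functionality of the neighbour circuit (`bitOracle σ ν q`: one bit of the sorted adjacency list of the
name in the first half of `q`, position in the second half), the request `1·_` by `name(ENTRANCE)` (the second
component of `gen s`), the empty request by `[]`. [cite: BarakEtAl2012, Def. 2.2] -/
def walkOracle (σ : CycleDatum d) (ν : NamingN d N) : Oracle
  | false :: q => bitOracle σ ν q
  | true :: _ => List.ofFn (ν (entrance d))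
  | [] => []

/-- **Winning the walk game**: the transcript algorithm `A`, run for `k` rounds on input `w` against the request oracle
of `(σ, ν)`, OUTPUTS a string with `name(EXIT)` as a prefix (the success event `{y | ans s <+: y}` of clause (C):
`ans s` is `name(EXIT)` zero-padded, `exitName_prefix_ans`). [folklore] -/
def WalkWin (A : OracleAlg (List Bool)) (k : ℕ) (w : List Bool) (σ : CycleDatum d) (ν : NamingN d N) : Prop :=
  match A.run (walkOracle σ ν) k w with
  | some y => List.ofFn (ν (GluedTrees.exit d)) <+: y
  | none => False

/-- Winning is decidable. [folklore] -/
instance (A : OracleAlg (List Bool)) (k : ℕ) (w : List Bool) (σ : CycleDatum d) (ν : NamingN d N) :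
    Decidable (WalkWin A k w σ ν) := by
  unfold WalkWin
  cases A.run (walkOracle σ ν) k w <;> infer_instance

/-- `WalkWin` unfolded as an existential. [folklore] -/
theorem walkWin_iff (A : OracleAlg (List Bool)) (k : ℕ) (w : List Bool) (σ : CycleDatum d) (ν : NamingN d N) :
    WalkWin A k w σ ν ↔ ∃ y, A.run (walkOracle σ ν) k w = some y ∧ List.ofFn (ν (GluedTrees.exit d)) <+: y := by
  unfold WalkWin
  cases A.run (walkOracle σ ν) k w with
  | none => simp
  | some y => simp

end Game

section Real

variable (Λ : Params) (P : PuncturablePRFScheme)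

/-- The game input at seed length `n`: the security parameter in unary (the walker obtains `name(ENTRANCE)` through
its request oracle). [folklore] -/
abbrev gameInput (n : ℕ) : List Bool := unaryEncodeNat n

/-- **The real black-box success probability** of the oracle adversary `𝒜` against the landed generator at seed
length `n`: the fraction of (key material `K ∈ {0,1}^{4·keyPartLen n}`, coins `r`) on which `𝒜`, run on
`⟨1ⁿ, r⟩` for `fuel` rounds against the request oracle of the instance `(σ_K, ν_K) = (Λ.cycleOfKey P n K,
Λ.namingOf P n K)`, outputs a string with `name_K(EXIT)` as a prefix.  (The instance of `gen s` depends on the seed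
only through `K = keyMaterial s`, uniform when `4·keyPartLen n ≤ n`.) [cite: ChildsEtAl2003, §4 Game 1] -/
def walkSuccessProb (𝒜 : OracleAdversary (List Bool)) (n : ℕ) : ℝ :=
  ((Finset.univ.filter fun p : List.Vector Bool (4 * Λ.keyPartLen n) ×
        List.Vector Bool (𝒜.coins.eval (gameInput n).length) =>
      WalkWin 𝒜.alg (𝒜.fuel.eval (gameInput n).length) (boolPair (gameInput n) p.2.toList)
        (Λ.cycleOfKey P n p.1.toList) (Λ.namingOf P n p.1.toList)).card : ℝ) /
    Fintype.card (List.Vector Bool (4 * Λ.keyPartLen n) × List.Vector Bool (𝒜.coins.eval (gameInput n).length))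

end Real

/-- **Black-box clause (C) for the landed generator**: every probabilistic polynomial-time oracle adversary, given
`1ⁿ` and black-box access to the instance `gen s` (the functionality of the shipped neighbour circuit and the name of
the ENTRANCE), outputs a string with `name(EXIT)` as a prefix with negligible probability over a uniform seed and its
coins — clause (C) of `WbwThesis` restricted to adversaries that use the obfuscated circuit as a black box (the
statement stage 7 targets; the classical game of ChildsEtAl2003 §4 for the landed instance format; no fact is
asserted by this definition). [folklore] -/
def BlackBoxClauseC (Λ : Params) (P : PuncturablePRFScheme) : Prop :=
  ∀ 𝒜 : OracleAdversary (List Bool), 𝒜.IsPPT (encodingList Bool) →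
    Asymptotics.SuperpolynomialDecay Filter.atTop (fun n : ℕ => (n : ℝ)) (walkSuccessProb Λ P 𝒜)

section Ideal

/-- **The ideal-II walk success probability**: the fraction of (table quadruple `T`, coins `r ∈ {0,1}^c`) on which
`A`, run for `k` rounds on `⟨x, r⟩` against the request oracle of the ideal-II instance `(codeCycle T d,
codeNaming T d)`, wins. [cite: ChildsEtAl2003, §4 Game 1] -/
def idealWalkSuccessProb (d μ : ℕ) (A : OracleAlg (List Bool)) (k : ℕ) (x : List Bool) (c : ℕ) : ℝ :=
  ((Finset.univ.filter fun p : CodeSpace μ × List.Vector Bool c =>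
      WalkWin A k (boolPair x p.2.toList) (codeCycle p.1 d) (codeNaming p.1 d)).card : ℝ) /
    Fintype.card (CodeSpace μ × List.Vector Bool c)

end Ideal

/-! ## §2 The scheduled product ensemble and the tables read off an oracle -/

section Sched

variable (Λ : Params) (P : PuncturablePRFScheme)

/-- **The scheduled product ensemble of the generator**: at parameter `n` (the SEED LENGTH), key `K` (the key
material, `4·keyPartLen n` bits) and input `z = i₀ i₁ x` (`2 + prfParam n` bits), the value `F_{kᵢ}(x)` of the PRF at
parameter `μ = Λ.prfParam n` under the `i`-th key cut out of `K` (`i = keyIdx z ∈ {0,1,2,3}` read off the first two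
bits, little-endian).  Its pseudorandomness `IsPRF (schedEval Λ P) (4·keyPartLen) (prfParam + 2) prfParam` — four
independent instances of `P` at the generator's schedule are jointly pseudorandom against adversaries polynomial in
`n` — is the hypothesis of stage 7. [cite: Goldreich2001, Def. 3.6.4] -/
def schedEval : FunctionEnsemble := fun n K z => P.eval (Λ.prfParam n) (Λ.key n K (keyIdx z).val) (z.drop 2)

end Sched

/-- **The PRF hypothesis of stage 7** (a predicate on `(Λ, P)` used as a HYPOTHESIS, no fact asserted): the
scheduled product ensemble is a pseudorandom function ensemble in the sense of the tree's `IsPRF` (Goldreich 2001,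
Def. 3.6.4) with key length `4·keyPartLen n`, input length `prfParam n + 2`, output length `prfParam n`. [folklore] -/
abbrev SchedPRF (Λ : Params) (P : PuncturablePRFScheme) : Prop :=
  IsPRF (schedEval Λ P) (fun n => 4 * Λ.keyPartLen n) (fun n => Λ.prfParam n + 2) Λ.prfParam

section Tables

variable {μ : ℕ}

/-- **The table quadruple read off an oracle**: table `i` at `v` is the `μ`-bit reading of the oracle's answer to
`tkey i ++ v`.  Every simulator of this stage queries its oracle only in this form and fits every answer to `μ` bits,
so that its behaviour against `O` is its behaviour against the ideal-II instance of `tabOf μ O`. [folklore] -/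
def tabOf (μ : ℕ) (O : Oracle) : CodeSpace μ :=
  ((fun v => vecOf μ (O (tkey 0 ++ List.ofFn v)), fun v => vecOf μ (O (tkey 1 ++ List.ofFn v))),
    (fun v => vecOf μ (O (tkey 2 ++ List.ofFn v)), fun v => vecOf μ (O (tkey 3 ++ List.ofFn v))))

/-- The `i`-th table read off an oracle. [folklore] -/
@[simp] theorem tabOf_tab (μ : ℕ) (O : Oracle) (i : Fin 4) (v : Fin μ → Bool) :
    (tabOf μ O).tab i v = vecOf μ (O (tkey i ++ List.ofFn v)) := by
  fin_cases i <;> rfl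

/-- **The table oracle of a table quadruple**: `tkey i ++ v ↦ Tᵢ(v)` on `(μ + 2)`-bit queries, `[]` otherwise (the
ideal-II oracle; `tabOf μ (tabOracle T) = T`). [folklore] -/
def tabOracle (T : CodeSpace μ) : Oracle := fun z =>
  if z.length = μ + 2 then List.ofFn (T.tab (keyIdx z) (vecOf μ (z.drop 2))) else []

end Tables

/-! ## §3 Adaptive straight-line oracle programs -/

section Prog

variable {α : Type}

/-- The answers collected by the adaptive straight-line program with query map `Q` on data `a` against the oracle
`O` in its first `m` steps: step `j` asks `Q a (answers so far)` and appends the answer. [cite: LadnerLynchSelman1975, §3] -/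
def progAnswers (Q : α → List (List Bool) → List Bool) (O : Oracle) (a : α) : ℕ → List (List Bool)
  | 0 => []
  | m + 1 => progAnswers Q O a m ++ [O (Q a (progAnswers Q O a m))]

/-- **The value of an adaptive straight-line program**: after `m` steps, post-process the data and the answers by
`G`. [cite: LadnerLynchSelman1975, §3] -/
def runProg (Q G : α → List (List Bool) → List Bool) (m : ℕ) (O : Oracle) (a : α) : List Bool :=
  G a (progAnswers Q O a m)

/-- `m` steps collect `m` answers. [folklore] -/
@[simp] theorem length_progAnswers (Q : α → List (List Bool) → List Bool) (O : Oracle) (a : α) (m : ℕ) :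
    (progAnswers Q O a m).length = m := by
  induction m with
  | zero => rfl
  | succ m ih => simp [progAnswers, ih]

/-- **The adaptive transducer** (on codes): while fewer than `m` answers have been received, ask
`FQ ⟨x, code of the answers⟩`; then output `FG ⟨x, code of the answers⟩` — the answers kept as the `listBool` code
`⟨1^{#answers}, ⟨a₀, ⟨a₁, …⟩⟩⟩`, which is exactly the second field of the step-function input of
`OracleAlg.IsPolyTime` (so the step map is `FQ`/`FG` themselves behind a counter test).  The adaptive sibling of the
tree's `ttFnAlgL`. [cite: LadnerLynchSelman1975, §3] -/
def adFnAlgL (FQ FG : List Bool → List Bool) (m : ℕ) : OracleAlg (List Bool) where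
  step x ans :=
    if ans.length < m then Sum.inl (FQ (boolPair x ((encodingList Bool).listBool.encode ans)))
    else Sum.inr (FG (boolPair x ((encodingList Bool).listBool.encode ans)))

/-- The step of the transducer before the last answer is the next query. [folklore] -/
theorem adFnAlgL_step_of_lt (FQ FG : List Bool → List Bool) (m : ℕ) (x : List Bool) {ans : List (List Bool)}
    (h : ans.length < m) :
    (adFnAlgL FQ FG m).step x ans = Sum.inl (FQ (boolPair x ((encodingList Bool).listBool.encode ans))) := by
  simp [adFnAlgL, h]

/-- The step of the transducer after `m` answers is the output. [folklore] -/
theorem adFnAlgL_step_of_le (FQ FG : List Bool → List Bool) (m : ℕ) (x : List Bool) {ans : List (List Bool)}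
    (h : m ≤ ans.length) :
    (adFnAlgL FQ FG m).step x ans = Sum.inr (FG (boolPair x ((encodingList Bool).listBool.encode ans))) := by
  simp [adFnAlgL, Nat.not_lt.2 h]

/-- `FQ` REALISES the plain-data query map `Q` along the data code `e` (the shape of a `CodeFP` witness for `Q` on the
code `pairE e (listE strE)`). [folklore] -/
def Realises (e : α → List Bool) (F : List Bool → List Bool) (Q : α → List (List Bool) → List Bool) : Prop :=
  ∀ (a : α) (as : List (List Bool)), F (boolPair (e a) ((encodingList Bool).listBool.encode as)) = Q a as

end Prog

/-- Registered helper stub of crux stmt-QuantumAdvantage-2340 (the gate admits a `--supports` file only if it proves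
a registered stub): `m` program steps collect `m` answers. [folklore] -/
theorem toolkit_phVocabulary :
    ∀ {α : Type} (Q : α → List (List Bool) → List Bool) (O : Oracle) (a : α) (m : ℕ),
      (progAnswers Q O a m).length = m :=
  fun Q O a m => length_progAnswers Q O a m

end Summit.QuantumAdvantage.QuantumAdvantage.Theorems.WbwObfuscatedGluedTrees.KnowledgeOfWalk.PrfHybrid

end
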